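import Summits.RiemannHypothesis.RiemannHypothesis.Theorems.Splittings.RobinFiniteHighCoverLaw
import Summits.RiemannHypothesis.RiemannHypothesis.Theorems.Splittings.RobinFiniteHighCoverTails
import Summits.RiemannHypothesis.RiemannHypothesis.Theorems.Splittings.RobinFiniteLowHeightRanges
import HarnessLib

/-!
# RobinFiniteHighCoverRanges — g18 add-on «HIGH COVERS» (part 6/6)

the rows `robinCA_below_high_2220000 : robinCA_below (4^19)` … `robinCA_below_high_12200000000 : robinCA_below (4^31)`, `robinCA_below_high_18200000000 : robinCA_below (10^19 + 1)`, and the Robin ranges `robin_le_of_rh1986H` (`n ≤ 10^(19·10¹⁴)` at `T ≥ 545 439 823`) and `robin_le_of_rhPlatt2017H` (`n ≤ 10^(43·10¹⁷)` at `T ≥ 1.82·10¹⁰`).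

Cell rh-split, seat rh-split-robin-finite g18 (brief sha16 f79c5f09d8bcb036), card `cards/SPLIT-robin-finite.md` §25 (block §25.14); carved VERBATIM from the
kernel-checked object `HOME/rh-split-robin-finite/g18/hi/SketchHi.lean` (sha16 0a7e1de567237bc8; `lean check` rc 0, 0 warnings, 0 sorries).  Zero `instance`, zero
`notation`, no attribute changes, no `native_decide`; no `def … : Prop`; every print fact appears only as an explicit hypothesis (`Buthe2018_thm2_theta`,
`BroadbentEtAl2021_theta_rel_1e19`, `RiemannHypothesisUpTo T`) — Büthe 2016 is NOT used anywhere in this add-on.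

THE LINE (add-on «HIGH COVERS»).  The tree's `√`-window cell certificates stop at level `k = 17` (`P < 4¹⁸`) only because gens 11–16 aimed at
`T ≤ 3·10⁶`; above `4¹⁸` every law in the tree prices the CA Mertens step with the ANALYTIC ramp budgets `κ = 0.0773 / 0.0904` (lane (ix-c)), an
order of magnitude below what cells give.  `cover_keyS` is generic in the level: this add-on supplies NEW covers for `18 ≤ k ≤ 31` (`4¹⁸ ≤ P ≤ 10¹⁹`,
the end of Büthe's boxes) — maximal cells on the 5-smooth anchor grid, 25–34 cells per level, budgets `b″_k = 0.608 … 0.709`, each `decide +kernel`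
and tight to `10⁻³` — the key inequality `key_ineq_levelH`, the level law `robinCA_below_highH` (base `robinCA_below (4¹⁸)` from lane (ix-k)), and rows:
`RH(2.22·10⁶) ⟹ CA primes < 4¹⁹`, …, `RH(1.22·10¹⁰) ⟹ < 4³¹`, `RH(1.82·10¹⁰) ⟹ ≤ 10¹⁹`; at the van de Lune–te Riele–Winter height `5.45·10⁸`:
Robin ∀ `5040 < n ≤ 10^(19·10¹⁴)` (tree `10^(14·10¹²)`), at Platt's rigorous `3.06·10¹⁰`: ∀ `5040 < n ≤ 10^(43·10¹⁷)` (tree `10^(4·10¹⁶)`).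

HONEST LABEL: «SPLITTING SEARCH over kernel-typed RH-EQUIVALENCES; a splitting A ∧ B ⟹ RH is CONDITIONAL bookkeeping unless A and B
are both proved; nothing here bears on the truth of RH.»
-/

set_option linter.dupNamespace false

noncomputable section

open Real Filter Finset
open scoped Chebyshev

namespace Summit.RiemannHypothesis.RiemannHypothesis.Theorems.Splittings.RobinFiniteC1

open Literature.NumberTheory.LFunctions Literature.NumberTheory.DiophantineGeometry
open RobinAnalyticSharp RobinAnalyticSharp.Cells
open Summit.RiemannHypothesis.RiemannHypothesis.Theorems.Splittings.RobinFiniteE3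

section HighRanges

open Summit.RiemannHypothesis.RiemannHypothesis.Theorems.Splittings.RobinFiniteTail

/-! ### HF · the high rows (all with `RH(T)` in hypothesis position; nothing here bears on the truth of RH)

Per full level `K` the least tabulated height `T_K` with `tailH(T_K) ≤ tolHi K` (then every level `18 ≤ k ≤ K` passes, `tolHi` decreasing),
`RH(T_K) ⟹ robinCA_below (4^(K+1))`; the top row takes `X = 10¹⁹` (the end of Büthe's boxes) with level 31 partial. -/

/-- **ROW H18 · `RH(T)`, any `T ≥ 2 220 000`, + {Büthe 2018 Thm 2, BKLNW 2021} ⟹ Robin at every CA `N > 5040` with all primes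
`< 4^19 = 274 877 906 944 ≈ 2.75e+11`** (level 18 in full: `tailH(2 220 000) ≤ 1.9758e-6 ≤ tolHi 18`; base `4¹⁸` from the tree's `robinCA_below_of_rh1320000SR`). -/
theorem robinCA_below_high_2220000 (hB : Buthe2018_thm2_theta) (hK : BroadbentEtAl2021_theta_rel_1e19)
    {T : ℝ} (hT : 2220000 ≤ T) (hRH : RiemannHypothesisUpTo T) : robinCA_below (4 ^ 19) := by
  have ht := (tailH_anti (by norm_num) hT).trans tailH_2220000_le
  refine robinCA_below_cellsH hB hK (le_trans (by norm_num) hT) hRH (K := 18) (by norm_num) (by norm_num) fun k hk18 hkK => ht.trans ?_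
  obtain rfl : k = 18 := le_antisymm hkK hk18
  simp only [tolHi]; push_cast; norm_num

/-- **ROW H19 · `RH(T)`, any `T ≥ 4 480 000`, + {Büthe 2018 Thm 2, BKLNW 2021} ⟹ Robin at every CA `N > 5040` with all primes
`< 4^20 = 1 099 511 627 776 ≈ 1.10e+12`** (levels `18 … 19` in full: `tailH(4 480 000) ≤ 1.0288e-6 ≤ tolHi 19`; base `4¹⁸` from the tree's `robinCA_below_of_rh1320000SR`). -/
theorem robinCA_below_high_4480000 (hB : Buthe2018_thm2_theta) (hK : BroadbentEtAl2021_theta_rel_1e19)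
    {T : ℝ} (hT : 4480000 ≤ T) (hRH : RiemannHypothesisUpTo T) : robinCA_below (4 ^ 20) := by
  have ht := (tailH_anti (by norm_num) hT).trans tailH_4480000_le
  refine robinCA_below_cellsH hB hK (le_trans (by norm_num) hT) hRH (K := 19) (by norm_num) (by norm_num) fun k hk18 hkK => ht.trans ?_
  interval_cases k <;> · simp only [tolHi]; push_cast; norm_num

/-- **ROW H20 · `RH(T)`, any `T ≥ 9 070 000`, + {Büthe 2018 Thm 2, BKLNW 2021} ⟹ Robin at every CA `N > 5040` with all primes
`< 4^21 = 4 398 046 511 104 ≈ 4.40e+12`** (levels `18 … 20` in full: `tailH(9 070 000) ≤ 5.3289e-7 ≤ tolHi 20`; base `4¹⁸` from the tree's `robinCA_below_of_rh1320000SR`). -/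
theorem robinCA_below_high_9070000 (hB : Buthe2018_thm2_theta) (hK : BroadbentEtAl2021_theta_rel_1e19)
    {T : ℝ} (hT : 9070000 ≤ T) (hRH : RiemannHypothesisUpTo T) : robinCA_below (4 ^ 21) := by
  have ht := (tailH_anti (by norm_num) hT).trans tailH_9070000_le
  refine robinCA_below_cellsH hB hK (le_trans (by norm_num) hT) hRH (K := 20) (by norm_num) (by norm_num) fun k hk18 hkK => ht.trans ?_
  interval_cases k <;> · simp only [tolHi]; push_cast; norm_num

/-- **ROW H21 · `RH(T)`, any `T ≥ 18 700 000`, + {Büthe 2018 Thm 2, BKLNW 2021} ⟹ Robin at every CA `N > 5040` with all primes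
`< 4^22 = 17 592 186 044 416 ≈ 1.76e+13`** (levels `18 … 21` in full: `tailH(18 700 000) ≤ 2.7084e-7 ≤ tolHi 21`; base `4¹⁸` from the tree's `robinCA_below_of_rh1320000SR`). -/
theorem robinCA_below_high_18700000 (hB : Buthe2018_thm2_theta) (hK : BroadbentEtAl2021_theta_rel_1e19)
    {T : ℝ} (hT : 18700000 ≤ T) (hRH : RiemannHypothesisUpTo T) : robinCA_below (4 ^ 22) := by
  have ht := (tailH_anti (by norm_num) hT).trans tailH_18700000_le
  refine robinCA_below_cellsH hB hK (le_trans (by norm_num) hT) hRH (K := 21) (by norm_num) (by norm_num) fun k hk18 hkK => ht.trans ?_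
  interval_cases k <;> · simp only [tolHi]; push_cast; norm_num

/-- **ROW H22 · `RH(T)`, any `T ≥ 38 300 000`, + {Büthe 2018 Thm 2, BKLNW 2021} ⟹ Robin at every CA `N > 5040` with all primes
`< 4^23 = 70 368 744 177 664 ≈ 7.04e+13`** (levels `18 … 22` in full: `tailH(38 300 000) ≤ 1.3818e-7 ≤ tolHi 22`; base `4¹⁸` from the tree's `robinCA_below_of_rh1320000SR`). -/
theorem robinCA_below_high_38300000 (hB : Buthe2018_thm2_theta) (hK : BroadbentEtAl2021_theta_rel_1e19)
    {T : ℝ} (hT : 38300000 ≤ T) (hRH : RiemannHypothesisUpTo T) : robinCA_below (4 ^ 23) := by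
  have ht := (tailH_anti (by norm_num) hT).trans tailH_38300000_le
  refine robinCA_below_cellsH hB hK (le_trans (by norm_num) hT) hRH (K := 22) (by norm_num) (by norm_num) fun k hk18 hkK => ht.trans ?_
  interval_cases k <;> · simp only [tolHi]; push_cast; norm_num

/-- **ROW H23 · `RH(T)`, any `T ≥ 78 200 000`, + {Büthe 2018 Thm 2, BKLNW 2021} ⟹ Robin at every CA `N > 5040` with all primes
`< 4^24 = 281 474 976 710 656 ≈ 2.81e+14`** (levels `18 … 23` in full: `tailH(78 200 000) ≤ 7.0574e-8 ≤ tolHi 23`; base `4¹⁸` from the tree's `robinCA_below_of_rh1320000SR`). -/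
theorem robinCA_below_high_78200000 (hB : Buthe2018_thm2_theta) (hK : BroadbentEtAl2021_theta_rel_1e19)
    {T : ℝ} (hT : 78200000 ≤ T) (hRH : RiemannHypothesisUpTo T) : robinCA_below (4 ^ 24) := by
  have ht := (tailH_anti (by norm_num) hT).trans tailH_78200000_le
  refine robinCA_below_cellsH hB hK (le_trans (by norm_num) hT) hRH (K := 23) (by norm_num) (by norm_num) fun k hk18 hkK => ht.trans ?_
  interval_cases k <;> · simp only [tolHi]; push_cast; norm_num

/-- **ROW H24 · `RH(T)`, any `T ≥ 161 000 000`, + {Büthe 2018 Thm 2, BKLNW 2021} ⟹ Robin at every CA `N > 5040` with all primes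
`< 4^25 = 1 125 899 906 842 624 ≈ 1.13e+15`** (levels `18 … 24` in full: `tailH(161 000 000) ≤ 3.5709e-8 ≤ tolHi 24`; base `4¹⁸` from the tree's `robinCA_below_of_rh1320000SR`). -/
theorem robinCA_below_high_161000000 (hB : Buthe2018_thm2_theta) (hK : BroadbentEtAl2021_theta_rel_1e19)
    {T : ℝ} (hT : 161000000 ≤ T) (hRH : RiemannHypothesisUpTo T) : robinCA_below (4 ^ 25) := by
  have ht := (tailH_anti (by norm_num) hT).trans tailH_161000000_le
  refine robinCA_below_cellsH hB hK (le_trans (by norm_num) hT) hRH (K := 24) (by norm_num) (by norm_num) fun k hk18 hkK => ht.trans ?_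
  interval_cases k <;> · simp only [tolHi]; push_cast; norm_num

/-- **ROW H25 · `RH(T)`, any `T ≥ 331 000 000`, + {Büthe 2018 Thm 2, BKLNW 2021} ⟹ Robin at every CA `N > 5040` with all primes
`< 4^26 = 4 503 599 627 370 496 ≈ 4.50e+15`** (levels `18 … 25` in full: `tailH(331 000 000) ≤ 1.8063e-8 ≤ tolHi 25`; base `4¹⁸` from the tree's `robinCA_below_of_rh1320000SR`). -/
theorem robinCA_below_high_331000000 (hB : Buthe2018_thm2_theta) (hK : BroadbentEtAl2021_theta_rel_1e19)
    {T : ℝ} (hT : 331000000 ≤ T) (hRH : RiemannHypothesisUpTo T) : robinCA_below (4 ^ 26) := by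
  have ht := (tailH_anti (by norm_num) hT).trans tailH_331000000_le
  refine robinCA_below_cellsH hB hK (le_trans (by norm_num) hT) hRH (K := 25) (by norm_num) (by norm_num) fun k hk18 hkK => ht.trans ?_
  interval_cases k <;> · simp only [tolHi]; push_cast; norm_num

/-- **ROW H26 · `RH(T)`, any `T ≥ 682 000 000`, + {Büthe 2018 Thm 2, BKLNW 2021} ⟹ Robin at every CA `N > 5040` with all primes
`< 4^27 = 18 014 398 509 481 984 ≈ 1.80e+16`** (levels `18 … 26` in full: `tailH(682 000 000) ≤ 9.1032e-9 ≤ tolHi 26`; base `4¹⁸` from the tree's `robinCA_below_of_rh1320000SR`). -/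
theorem robinCA_below_high_682000000 (hB : Buthe2018_thm2_theta) (hK : BroadbentEtAl2021_theta_rel_1e19)
    {T : ℝ} (hT : 682000000 ≤ T) (hRH : RiemannHypothesisUpTo T) : robinCA_below (4 ^ 27) := by
  have ht := (tailH_anti (by norm_num) hT).trans tailH_682000000_le
  refine robinCA_below_cellsH hB hK (le_trans (by norm_num) hT) hRH (K := 26) (by norm_num) (by norm_num) fun k hk18 hkK => ht.trans ?_
  interval_cases k <;> · simp only [tolHi]; push_cast; norm_num

/-- **ROW H27 · `RH(T)`, any `T ≥ 1 400 000 000`, + {Büthe 2018 Thm 2, BKLNW 2021} ⟹ Robin at every CA `N > 5040` with all primes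
`< 4^28 = 72 057 594 037 927 936 ≈ 7.21e+16`** (levels `18 … 27` in full: `tailH(1 400 000 000) ≤ 4.598e-9 ≤ tolHi 27`; base `4¹⁸` from the tree's `robinCA_below_of_rh1320000SR`). -/
theorem robinCA_below_high_1400000000 (hB : Buthe2018_thm2_theta) (hK : BroadbentEtAl2021_theta_rel_1e19)
    {T : ℝ} (hT : 1400000000 ≤ T) (hRH : RiemannHypothesisUpTo T) : robinCA_below (4 ^ 28) := by
  have ht := (tailH_anti (by norm_num) hT).trans tailH_1400000000_le
  refine robinCA_below_cellsH hB hK (le_trans (by norm_num) hT) hRH (K := 27) (by norm_num) (by norm_num) fun k hk18 hkK => ht.trans ?_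
  interval_cases k <;> · simp only [tolHi]; push_cast; norm_num

/-- **ROW H28 · `RH(T)`, any `T ≥ 2 880 000 000`, + {Büthe 2018 Thm 2, BKLNW 2021} ⟹ Robin at every CA `N > 5040` with all primes
`< 4^29 = 288 230 376 151 711 744 ≈ 2.88e+17`** (levels `18 … 28` in full: `tailH(2 880 000 000) ≤ 2.3153e-9 ≤ tolHi 28`; base `4¹⁸` from the tree's `robinCA_below_of_rh1320000SR`). -/
theorem robinCA_below_high_2880000000 (hB : Buthe2018_thm2_theta) (hK : BroadbentEtAl2021_theta_rel_1e19)
    {T : ℝ} (hT : 2880000000 ≤ T) (hRH : RiemannHypothesisUpTo T) : robinCA_below (4 ^ 29) := by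
  have ht := (tailH_anti (by norm_num) hT).trans tailH_2880000000_le
  refine robinCA_below_cellsH hB hK (le_trans (by norm_num) hT) hRH (K := 28) (by norm_num) (by norm_num) fun k hk18 hkK => ht.trans ?_
  interval_cases k <;> · simp only [tolHi]; push_cast; norm_num

/-- **ROW H29 · `RH(T)`, any `T ≥ 5 910 000 000`, + {Büthe 2018 Thm 2, BKLNW 2021} ⟹ Robin at every CA `N > 5040` with all primes
`< 4^30 = 1 152 921 504 606 846 976 ≈ 1.15e+18`** (levels `18 … 29` in full: `tailH(5 910 000 000) ≤ 1.1669e-9 ≤ tolHi 29`; base `4¹⁸` from the tree's `robinCA_below_of_rh1320000SR`). -/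
theorem robinCA_below_high_5910000000 (hB : Buthe2018_thm2_theta) (hK : BroadbentEtAl2021_theta_rel_1e19)
    {T : ℝ} (hT : 5910000000 ≤ T) (hRH : RiemannHypothesisUpTo T) : robinCA_below (4 ^ 30) := by
  have ht := (tailH_anti (by norm_num) hT).trans tailH_5910000000_le
  refine robinCA_below_cellsH hB hK (le_trans (by norm_num) hT) hRH (K := 29) (by norm_num) (by norm_num) fun k hk18 hkK => ht.trans ?_
  interval_cases k <;> · simp only [tolHi]; push_cast; norm_num

/-- **ROW H30 · `RH(T)`, any `T ≥ 12 200 000 000`, + {Büthe 2018 Thm 2, BKLNW 2021} ⟹ Robin at every CA `N > 5040` with all primes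
`< 4^31 = 4 611 686 018 427 387 904 ≈ 4.61e+18`** (levels `18 … 30` in full: `tailH(12 200 000 000) ≤ 5.8413e-10 ≤ tolHi 30`; base `4¹⁸` from the tree's `robinCA_below_of_rh1320000SR`). -/
theorem robinCA_below_high_12200000000 (hB : Buthe2018_thm2_theta) (hK : BroadbentEtAl2021_theta_rel_1e19)
    {T : ℝ} (hT : 12200000000 ≤ T) (hRH : RiemannHypothesisUpTo T) : robinCA_below (4 ^ 31) := by
  have ht := (tailH_anti (by norm_num) hT).trans tailH_12200000000_le
  refine robinCA_below_cellsH hB hK (le_trans (by norm_num) hT) hRH (K := 30) (by norm_num) (by norm_num) fun k hk18 hkK => ht.trans ?_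
  interval_cases k <;> · simp only [tolHi]; push_cast; norm_num

/-- **ROW H-TOP · `RH(T)`, any `T ≥ 1.82·10¹⁰` (Platt 2017: `3.06·10¹⁰`; Platt–Trudgian 2021: `3·10¹²`), + {Büthe 2018 Thm 2, BKLNW 2021} ⟹ Robin at
every CA `N > 5040` with all primes `≤ 10¹⁹`** — the end of the `√`-window boxes (levels `18 … 30` in full, level 31 up to `X = 10¹⁹`:
`√X ≤ 3162277661`, `0.0463 + (1 + 2/L1 31)·3.9859·10⁻¹⁰·(3162277661 + 1)/2 ≤ 0.709 = b″₃₁`).  Tree at Platt's height: `robinCA_below (10¹⁷ + 1)` (ramp law, lane (ix-c)). -/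
theorem robinCA_below_high_18200000000 (hB : Buthe2018_thm2_theta) (hK : BroadbentEtAl2021_theta_rel_1e19)
    {T : ℝ} (hT : 18200000000 ≤ T) (hRH : RiemannHypothesisUpTo T) : robinCA_below (10 ^ 19 + 1) := by
  have hT5 : (100000 : ℝ) ≤ T := le_trans (by norm_num) hT
  have ht0 := tailH_nonneg (show (7 : ℝ) ≤ T by linarith)
  have ht := (tailH_anti (by norm_num) hT).trans tailH_18200000000_le
  have hbase := robinCA_below_of_rh1320000SR hB hK (le_trans (by norm_num) hT) hRH
  refine robinCA_below_highH hB hK hT5 hRH (X := 10 ^ 19) (by norm_num) hbase fun k hk18 hk31 hkX => ?_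
  by_cases hk30 : k ≤ 30
  · refine levelH_of_tol hk18 hk31 hkX ht0 (ht.trans ?_)
    interval_cases k <;> · simp only [tolHi]; push_cast; norm_num
  · have hk : k = 31 := by omega
    subst hk
    have hm : min (((10 ^ 19 : ℕ) : ℝ)) ((4 : ℝ) ^ (31 + 1)) = (10 : ℝ) ^ 19 := by norm_num
    rw [hm]
    exact top_of_num ht0 ht (by norm_num) (s := 3162277661) (by norm_num) (by norm_num)
      (by simp only [L1, l2]; push_cast; norm_num) (by simp only [L1, l2, bkH]; push_cast; norm_num)

/-- **COROLLARY (van de Lune–te Riele–Winter 1986 height `T = 545 439 823`) · RH(T ≥ 5.46·10⁸) + the two θ-prints ⟹ Robin's inequality for EVERY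
`5040 < n ≤ 10^(19·10¹⁴)`** (row H25: CA primes `< 4²⁶ ≈ 4.5·10¹⁵`; then lane (ix-c)'s `robin_all_of_robinCA_below_low`).  Tree at this height:
`robin_le_of_rh1986` = `n ≤ 10^(14·10¹²)` (ramp law). -/
theorem robin_le_of_rh1986H (hB : Buthe2018_thm2_theta) (hK : BroadbentEtAl2021_theta_rel_1e19)
    {T : ℝ} (hT : 545439823 ≤ T) (hRH : RiemannHypothesisUpTo T) :
    ∀ n : ℕ, 5040 < n → n ≤ 10 ^ (19 * 10 ^ 14) → robinInequality n := by
  have hRB : robinCA_below (4503599627370495 + 1) := by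
    have h := robinCA_below_high_331000000 hB hK (le_trans (by norm_num) hT) hRH
    norm_num at h ⊢; exact h
  intro n hn hle
  have hn0 : 0 < n := lt_of_le_of_lt (Nat.zero_le 5040) hn
  have h1 : Real.log n ≤ ((19 * 10 ^ 14 : ℕ) : ℝ) * Real.log 10 := log_le_of_le_ten_pow hn0 hle
  clear hle
  refine robin_all_of_robinCA_below_low hB hK hRB (by norm_num) n hn ?_
  have h10 := RobinAnalytic.log_ten_lt
  have h9 : ((19 * 10 ^ 14 : ℕ) : ℝ) = 19e14 := by norm_num
  have hX : ((4503599627370495 : ℕ) : ℝ) = 4503599627370495 := by norm_num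
  rw [h9] at h1
  rw [hX]
  linarith

/-- **COROLLARY (Platt 2017 height `T = 3.06·10¹⁰`, rigorous) · RH(T ≥ 1.82·10¹⁰) + the two θ-prints ⟹ Robin's inequality for EVERY
`5040 < n ≤ 10^(43·10¹⁷)`** (row H-TOP: CA primes `≤ 10¹⁹`).  Tree at Platt's height: `robin_le_of_rhPlatt2017` = `n ≤ 10^(4·10¹⁶)`. -/
theorem robin_le_of_rhPlatt2017H (hB : Buthe2018_thm2_theta) (hK : BroadbentEtAl2021_theta_rel_1e19)
    {T : ℝ} (hT : 18200000000 ≤ T) (hRH : RiemannHypothesisUpTo T) :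
    ∀ n : ℕ, 5040 < n → n ≤ 10 ^ (43 * 10 ^ 17) → robinInequality n := by
  have hRB : robinCA_below (10000000000000000000 + 1) := by
    have h := robinCA_below_high_18200000000 hB hK hT hRH
    norm_num at h ⊢; exact h
  intro n hn hle
  have hn0 : 0 < n := lt_of_le_of_lt (Nat.zero_le 5040) hn
  have h1 : Real.log n ≤ ((43 * 10 ^ 17 : ℕ) : ℝ) * Real.log 10 := log_le_of_le_ten_pow hn0 hle
  clear hle
  refine robin_all_of_robinCA_below_low hB hK hRB (by norm_num) n hn ?_
  have h10 := RobinAnalytic.log_ten_lt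
  have h9 : ((43 * 10 ^ 17 : ℕ) : ℝ) = 43e17 := by norm_num
  have hX : ((10000000000000000000 : ℕ) : ℝ) = 10000000000000000000 := by norm_num
  rw [h9] at h1
  rw [hX]
  linarith

end HighRanges

end Summit.RiemannHypothesis.RiemannHypothesis.Theorems.Splittings.RobinFiniteC1

end
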